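import Summits.HodgeConjecture.HodgeConjecture.Theorems.Ring2AbelianAllAndrePrimitiveHodgeRiemannInjective
import Summits.HodgeConjecture.HodgeConjecture.Theorems.Ring2AbelianAllAndreFibreClassBalancedNoGo
import Summits.HodgeConjecture.HodgeConjecture.Theorems.Ring2AbelianAllAndreLiebermanDischargedRows
import Summits.HodgeConjecture.HodgeConjecture.Theorems.Ring2AbelianAllAndrePrimitiveLiftRankOne
import HarnessLib

/-!
# Ring 2 · sub-cell AbelianAll (ALL ABELIAN VARIETIES), André axis, part XXIII-c — `B_min` AS ONE LEFSCHETZ COMPONENT PER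
# PRIMITIVE DEGREE: the primitive lift (Prim)_t(r) from the SINGLE clause `A_r(𝒳, K)` (`L_K^{d+1-2r} : Nʳ(𝒳) → N^{d+1-r}(𝒳)`
# ONTO) of Grothendieck's standard conjecture `A` for the total space — at EVERY point of EVERY compact abelian pencil; the
# whole André-axis lift from the graded clauses; W₆ with rank-one `H⁴`-invariants from `A₃(𝒳⁷, K)` ALONE

HONEST FRAMING (page 1, verbatim): **research route, not a corollary; conditional on HC_CM plus one named
minimal statement.** Cell line: research route conditional on HC_CM; not a corollary; Q11.4-sentence-2
already refuted in dim ≥ 3. Nothing in this file proves a case of the Hodge conjecture for an abelian variety; `HC_CM`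
(`Theses.RankFourFaces.CMAbelianHodge`) does not occur in this file (the node-level rows are part XXIII-d); item
`Theses.RankFourFaces.CMToAbelian` (stmt-16267) OPEN and not closed here. Seat `pub-hodge-ring2-ab-andre-2`, gen 15; brief (ii)
"minimise: replace B by algebraicity of specific Lefschetz components — record each version" and (iii) "B for abelian varieties
is known (Lieberman) — identify precisely why that does not suffice; smallest open instance as a find-the-cycle problem".

## The argument (`f : 𝒳 ⟶ S` compact pencil of abelian `d`-folds, `t` any point, `j = j_t`, `K = D.Hη`, `κ = j^*K`, `2(p+1) + m = d`)

`θ = (L_K^{m+1})⁻¹ : H^{2(p+1+m+1)}(𝒳) ⥲ H^{2(p+1)}(𝒳)`, `N = θ j_* L_κᵐ`, `M = N j^* ∈ End H^{2(p+1)}(𝒳)`, `Φ = j^* N`, `pr` the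
`κ`-primitive projection, `Ψ = pr ∘ Φ`.
(1) ALGEBRAICITY FROM `A_{p+1}(𝒳, K)`: if `j^*W ∈ N^{p+1}(X_t)` then `j_* L_κᵐ j^*W ∈ N^{p+1+m+1}(𝒳)` and the clause gives an
ALGEBRAIC `x` with `L_K^{m+1}x = j_*L_κᵐj^*W`, i.e. `x = MW`; inductively `M^{l+1}W ∈ N^{p+1}(𝒳)` (`W` itself need not be algebraic).
(2) `Φ` KILLS THE COPRIMITIVE INVARIANT CLASSES: `Φ(L_κ^{s+1} j^*B) = j^*θ([X_t] ∪ L_K^{m+s+1}B) = j^*([X_t] ∪ L_KˢB) = 0` since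
`j^*[X_t] = 0` (part XV-a); hence `Φ(j^*W) = Φ(pr j^*W)` and `pr j^*(MˡW) = Ψˡ(j^*W)` for `j^*W` primitive.
(3) `Ψ` preserves `E = P ∩ Im j^*` and is INJECTIVE there (part XXIII-b, Hodge–Riemann on the total space); by Cayley–Hamilton
(`Ψ|_E` injective endomorphism of a finite-dimensional space, part XXII-c `exists_sum_smul_pow_comp_eq_id`)
`ξ = Σ c_k Ψ^{k+1}ξ = pr j^* W'` with `W' = Σ c_k M^{k+1}W` ALGEBRAIC.
(4) the top primitive part of `j^*W'` lies in `j^*N^{p+1}(𝒳)` (part XXIII-b §5, using (L)_t(p)). Hence `ξ ∈ j^*N^{p+1}(𝒳)`.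
WHERE LIEBERMAN STOPS AND WHAT REPLACES `B(𝒳)`: `B(X_t)` (Lieberman) supplies Kleiman's clause on the FIBRE (parts XXI/XXII); the one
input from the NON-abelian total space is the surjectivity `L_K^{m+1} : N^{p+1}(𝒳) → N^{p+1+m+1}(𝒳)` — one bidegree of `A(𝒳, K)`
per primitive degree, instead of `B(𝒳)` (node (5)) or the whole of `A(𝒳, η)` (ab-andre-1's node `CMPointedPencilStandardA`); the
Hodge–Riemann relations of `𝒳` make the fixed-point scheme `Ψ` invertible, so that NO numerical equivalence / conjecture `D` on `𝒳`
is needed (contrast parts XVIII-a…e: `A` below AND at the degree, through `D`).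

## What is proved (theorems only; no definition, no named fact, no sorry; `HC_CM` absent)

§6 **`primitiveLift_succ_of_lefschetzDegree`** ((L)_t(p) ∧ `A(X_t,κ)` below `p+1` ∧ `A_{p+1}(𝒳,K)` ⟹ (Prim)_t(p+1)). §7
`exists_kaehlerRationalDatum_polarization_fibres` (data `D` whose class polarises every fibre exist),
**`primitiveLift_succ_of_lefschetzDegree'`** (the fibre clause discharged by Lieberman, part XXII-d),
**`comap_le_sup_of_forall_lefschetzDegree`** (the lift in EVERY degree at `t` from the clauses `A_r(𝒳,K)`, `4 ≤ 2r ≤ d`),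
**`forall_comap_le_sup_of_rankOne_of_lefschetzDegree_three`** (W₆: on a compact pencil of abelian SIXFOLDS with rank-one
`H⁴`-invariants at `t`, the whole lift at `t` ⟸ `L_K : N³(𝒳) → N⁴(𝒳)` onto — the find-the-cycle problem of RING2-MAP AA2.102/107
traded for: every codimension-`4` algebraic class of the sevenfold is homologically `K ∪` a codimension-`3` algebraic class).
EDGE LABELS (RING2-MAP §AbelianAll gen 15): all K (kernel, no fact, no `HC_CM`).

References: Grothendieck1968 (§3 p. 196); Kleiman1968AlgebraicCycles (§3, Prop. 3.8); Lieberman1968 (Thm. 1); Milne2020HodgeClassesAV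
(Prop. 1 p. 7); Andre1996Motifs (§5.1, §6.3 Remarque 2); Abdulali1994FamiliesAV (p. 1122, Conj. 5.3); VoisinHodgeI2002 (§6.2.3
Cor. 6.26, §6.3.2 Thm. 6.32, §7.1.2); VoisinHodgeII2003 (Thm. 4.18, Prop. 9.20); vanGeemen1994HodgeAV (Thm. 6.12).
-/

noncomputable section

set_option linter.dupNamespace false

namespace Summit.HodgeConjecture.HodgeConjecture.Ring2.AbelianAll

open CategoryTheory AlgebraicGeometry
open Literature.AlgebraicGeometry Literature.AlgebraicGeometry.Motives
open Literature.AlgebraicGeometry.HodgeTheory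
open Literature.AlgebraicTopology.SingularHomology (singularCohomology cupProduct cupProduct_map)
open Literature.Geometry.Kaehler (lefschetzOperator lefschetzPow HasHardLefschetzProperty)
/-! ## §6 THE PRIMITIVE LIFT FROM ONE LEFSCHETZ COMPONENT: (L)_t(p) ∧ `A_{p+1}(𝒳, K)` ⟹ (Prim)_t(p+1) -/

section Main

variable {𝒳 S : SchemeOver ℂ} {d : ℕ} {f : 𝒳 ⟶ S}

/-- **(Prim)_t(p+1) FROM THE SINGLE LEFSCHETZ CLAUSE `A_{p+1}(𝒳, K)`.** Let `f : 𝒳 ⟶ S` be a compact pencil of abelian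
`d`-folds, `t` ANY point, `D` a Kähler–rational datum of `𝒳` (`K = D.Hη ∈ N¹(𝒳)`, the rational hyperplane class) whose
restrictions to the fibres have the hard Lefschetz property and whose restriction `κ = j_t^*K` polarises `X_t`, and
`2(p+1) + m = d`. Assume Kleiman's clause `A(X_t, κ)` below `p + 1` (free for abelian fibres), the lift (L)_t(p) one degree
below, and the SINGLE clause of Grothendieck's `A(𝒳, K)` in codimension `p + 1`:
`A_{p+1}(𝒳, K)` : `L_K^{m+1} : N^{p+1}(𝒳) → N^{p+1+m+1}(𝒳)` is ONTO. Then (Prim)_t(p+1): every `κ`-primitive invariant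
algebraic class `ξ ∈ P^{2p+2}(X_t) ∩ N^{p+1}(X_t) ∩ Im j_t^*` lies in `j_t^* N^{p+1}(𝒳)`.
PROOF. `θ = (L_K^{m+1})⁻¹`, `N = θ j_{t*} L_κᵐ`, `M = N j_t^*`, `Φ = j_t^* N`, `pr` = top primitive projection, `Ψ = pr ∘ Φ`.
(1) `M W ∈ N^{p+1}(𝒳)` whenever `j^*W ∈ N^{p+1}(X_t)`: `j_{t*}L_κᵐ j^*W` is algebraic and `A_{p+1}` gives an algebraic `x` with
`L^{m+1}x = j_{t*}L_κᵐ j^*W`, i.e. `x = MW`; inductively `M^{l+1} W ∈ N^{p+1}(𝒳)`. (2) `Φ` kills the coprimitive invariant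
classes (`Φ(L^{s+1} j^*B) = j^*θ(F ∪ L_K^{m+s+1}B) = j^*(F ∪ L_Kˢ B) = 0`, `j^*F = 0`), so `Φ(j^*W) = Φ(pr j^*W)` and
`pr j^*(Mˡ W) = Ψˡ ξ`. (3) `Ψ` restricted to `E = P ∩ Im j^*` is INJECTIVE (§4, Hodge–Riemann on `𝒳`), hence by Cayley–Hamilton
`ξ = Σ c_k Ψ^{k+1} ξ = pr j^* W'` with `W' = Σ c_k M^{k+1} W` ALGEBRAIC. (4) The top primitive part of `j^*W'` lies in
`j^*N^{p+1}(𝒳)` (§5). [cite: Grothendieck1968, §3 p. 196 (A(X))] [cite: Kleiman1968AlgebraicCycles, §3]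
[cite: VoisinHodgeI2002, §6.3.2 Thm. 6.32, §6.2.3 Cor. 6.26 and §7.1.2] [cite: VoisinHodgeII2003, §4.3.1 Thm. 4.18 and §9.2.4 Prop. 9.20] -/
theorem primitiveLift_succ_of_lefschetzDegree (hf : IsCompactAbelianPencil f d) (t : ComplexPoints S)
    (D : KaehlerRationalDatum (d + 1) 𝒳)
    (hK : ∀ s : ComplexPoints S, HasHardLefschetzProperty (complexBetti.map (fiberι f s) 2 D.Hη) d)
    (hKt : IsPolarizationClass d (fiberOver f t) (complexBetti.map (fiberι f t) 2 D.Hη)) {p m : ℕ}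
    (hpm : 2 * (p + 1) + m = d)
    (hA : ∀ (p' r' q' : ℕ), p' < p + 1 → p' + (p + 1) ≤ d → 2 * p' + r' = d → p' + r' = q' →
      Set.SurjOn (lefschetzPow (complexBetti.map (fiberι f t) 2 D.Hη) r' (2 * p'))
        (algebraicClasses (fiberOver f t) p' : Set (complexBetti (fiberOver f t) (2 * p')))
        (supportedClasses (fiberOver f t) (2 * p' + 2 * r') q'))
    (hprev : (algebraicClasses (fiberOver f t) p).comap (complexBetti.map (fiberι f t) (2 * p)).hom ≤
      algebraicClasses 𝒳 p ⊔ LinearMap.ker (complexBetti.map (fiberι f t) (2 * p)).hom)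
    (hAr : ∀ y ∈ algebraicClasses 𝒳 (p + 1 + m + 1), ∃ x ∈ algebraicClasses 𝒳 (p + 1),
      lefschetzPowTo D.Hη (m + 1) (2 * (p + 1)) (2 * (p + 1 + m + 1)) (by omega) x = y) :
    ∀ ξ ∈ algebraicClasses (fiberOver f t) (p + 1),
      ξ ∈ primitiveClasses (complexBetti.map (fiberι f t) 2 D.Hη) d (2 * (p + 1)) →
      ξ ∈ LinearMap.range (complexBetti.map (fiberι f t) (2 * (p + 1))).hom →
      ξ ∈ (algebraicClasses 𝒳 (p + 1)).map (complexBetti.map (fiberι f t) (2 * (p + 1))).hom := by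
  classical
  intro ξ hξalg hξP hξI
  have h𝒳 := hf.isSmoothProjective_total
  have hXt := hf.isSmoothProjective_fiberOver t
  haveI := finite_complexBetti hXt (2 * (p + 1))
  set K := D.Hη with hKdef
  have hKalg : K ∈ algebraicClasses 𝒳 1 := (isPolarizationClass_Hη h𝒳 D).mem_algebraicClasses
  set κ := complexBetti.map (fiberι f t) 2 K with hκdef
  -- hard Lefschetz on `𝒳`: `θ = (L_K^{m+1})⁻¹ : H^{2(p+1+m+1)}(𝒳) → H^{2(p+1)}(𝒳)`
  have hbij : Function.Bijective (lefschetzPowTo K (m + 1) (2 * (p + 1)) (2 * (p + 1 + m + 1)) (by omega)) :=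
    bijective_lefschetzPowTo_of_hasHardLefschetz K (isPolarizationClass_Hη h𝒳 D).hasHardLefschetz
      (by omega : 2 * (p + 1) + (m + 1) = d + 1) _ _
  set Le := LinearEquiv.ofBijective _ hbij with hLe
  set θ : complexBetti 𝒳 (2 * (p + 1 + m + 1)) →ₗ[ℂ] complexBetti 𝒳 (2 * (p + 1)) := Le.symm.toLinearMap with hθdef
  have hθ : ∀ y, lefschetzPowTo K (m + 1) (2 * (p + 1)) (2 * (p + 1 + m + 1)) (by omega) (θ y) = y :=
    fun y ↦ Le.apply_symm_apply y
  have hθ' : ∀ x, θ (lefschetzPowTo K (m + 1) (2 * (p + 1)) (2 * (p + 1 + m + 1)) (by omega) x) = x :=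
    fun x ↦ Le.symm_apply_apply x
  -- the operators `N = θ j_* L_κᵐ`, `M = N j^*`, `pr`, `Ψ = pr j^* N`
  set Lκ := lefschetzPowTo κ m (2 * (p + 1)) (2 * (p + 1 + m)) (by omega) with hLκ
  let N : complexBetti (fiberOver f t) (2 * (p + 1)) →ₗ[ℂ] complexBetti 𝒳 (2 * (p + 1)) :=
    θ ∘ₗ fiberGysin hf t (p + 1 + m) ∘ₗ Lκ
  have hN : ∀ x, N x = θ (fiberGysin hf t (p + 1 + m) (Lκ x)) := fun _ ↦ rfl
  let M : Module.End ℂ (complexBetti 𝒳 (2 * (p + 1))) := N ∘ₗ (complexBetti.map (fiberι f t) (2 * (p + 1))).hom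
  have hM : ∀ W, M W = N (complexBetti.map (fiberι f t) (2 * (p + 1)) W) := fun _ ↦ rfl
  let top : {P : ℕ × ℕ // P.1 + 2 * P.2 = 2 * (p + 1)} := ⟨(2 * (p + 1), 0), by omega⟩
  let pr : complexBetti (fiberOver f t) (2 * (p + 1)) →ₗ[ℂ] complexBetti (fiberOver f t) (2 * (p + 1)) :=
    primitivePart κ d (hK t) (hvan_fiberOver hf t) top
  have hpr : ∀ x, pr x = primitivePart κ d (hK t) (hvan_fiberOver hf t) top x := fun _ ↦ rfl
  let Ψ : Module.End ℂ (complexBetti (fiberOver f t) (2 * (p + 1))) :=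
    pr ∘ₗ (complexBetti.map (fiberι f t) (2 * (p + 1))).hom ∘ₗ N
  have hΨ : ∀ x, Ψ x = pr (complexBetti.map (fiberι f t) (2 * (p + 1)) (N x)) := fun _ ↦ rfl
  -- (1) `M` maps classes with algebraic fibre restriction to ALGEBRAIC classes: this is where `A_{p+1}(𝒳, K)` enters
  have hMalg : ∀ W : complexBetti 𝒳 (2 * (p + 1)),
      complexBetti.map (fiberι f t) (2 * (p + 1)) W ∈ algebraicClasses (fiberOver f t) (p + 1) →
        M W ∈ algebraicClasses 𝒳 (p + 1) := by
    intro W hW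
    have hB : fiberGysin hf t (p + 1 + m) (Lκ (complexBetti.map (fiberι f t) (2 * (p + 1)) W)) ∈
        algebraicClasses 𝒳 (p + 1 + m + 1) :=
      fiberGysin_mem_algebraicClasses hf t
        (lefschetzPowTo_mem_algebraicClasses hXt hKt.mem_algebraicClasses hW m (p + 1 + m) rfl _)
    obtain ⟨x, hx, hxe⟩ := hAr _ hB
    rw [hM, hN, ← hxe, hθ']
    exact hx
  have hMpow : ∀ (l : ℕ) (W : complexBetti 𝒳 (2 * (p + 1))),
      complexBetti.map (fiberι f t) (2 * (p + 1)) W ∈ algebraicClasses (fiberOver f t) (p + 1) →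
        (M ^ (l + 1)) W ∈ algebraicClasses 𝒳 (p + 1) := by
    intro l
    induction l with
    | zero => intro W hW; rw [zero_add, pow_one]; exact hMalg W hW
    | succ l ih =>
      intro W hW
      rw [pow_succ', Module.End.mul_apply]
      exact hMalg _ (algebraicClasses_sup_ker_le_comap hf (p + 1) t (Submodule.mem_sup_left (ih W hW)))
  -- (2) `Φ = j^* N` kills the coprimitive invariant classes
  have hΦcop : ∀ (a s : ℕ) (hP : a + 2 * (s + 1) = 2 * (p + 1)) (B : complexBetti 𝒳 a),
      complexBetti.map (fiberι f t) (2 * (p + 1))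
        (N (lefschetzPowTo κ (s + 1) a (2 * (p + 1)) hP (complexBetti.map (fiberι f t) a B))) = 0 := by
    intro a s hP B
    have h2 : 2 * p + 2 * (0 + 1) = 2 * (p + 1) := by ring
    -- `L_κᵐ L_κ^{s+1} j^*B = j^* L_K^{m+1} L_Kˢ B`
    have hLL : Lκ (lefschetzPowTo κ (s + 1) a (2 * (p + 1)) hP (complexBetti.map (fiberι f t) a B)) =
        complexBetti.map (fiberι f t) (2 * (p + 1 + m))
          (lefschetzPowTo K (m + 1) (2 * p) (2 * (p + 1 + m)) (by omega) (lefschetzPowTo K s a (2 * p) (by omega) B)) := by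
      rw [hLκ, lefschetzPowTo_lefschetzPowTo κ m hP (show 2 * (p + 1) + 2 * m = 2 * (p + 1 + m) by omega)
          (show a + 2 * (s + 1 + m) = 2 * (p + 1 + m) by omega),
        lefschetzPowTo_lefschetzPowTo K (m + 1) (show a + 2 * s = 2 * p by omega)
          (show 2 * p + 2 * (m + 1) = 2 * (p + 1 + m) by omega) (show a + 2 * (s + (m + 1)) = 2 * (p + 1 + m) by omega),
        map_fiberι_lefschetzPowTo t K (s + (m + 1)) a (2 * (p + 1 + m)) _ B]
      exact lefschetzPowTo_congr_exponent κ (by omega) _ _ _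
    rw [hN, hLL, fiberGysin_map_fiberι_eq_cupProduct hf t,
      cupProduct_lefschetzPowTo_left K (m + 1) (show 2 * p + 2 * (m + 1) = 2 * (p + 1 + m) by omega)
        (show 2 * (p + 1 + m) + 2 * (0 + 1) = 2 * (p + 1 + m + 1) by ring) h2
        (show 2 * (p + 1) + 2 * (m + 1) = 2 * (p + 1 + m + 1) by omega), hθ']
    change complexBetti.map (fiberι f t) (2 * (p + 1)) (cupProduct h2 _ _) = 0
    rw [show complexBetti.map (fiberι f t) (2 * (p + 1))
        (cupProduct h2 (lefschetzPowTo K s a (2 * p) (by omega) B)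
          (fiberGysin hf t 0 (singularCohomology.one ℂ (ComplexPoints (fiberOver f t))))) =
        cupProduct h2 (complexBetti.map (fiberι f t) (2 * p) (lefschetzPowTo K s a (2 * p) (by omega) B))
          (complexBetti.map (fiberι f t) (2 * (0 + 1))
            (fiberGysin hf t 0 (singularCohomology.one ℂ (ComplexPoints (fiberOver f t))))) from
        cupProduct_map _ h2 _ _,
      map_fiberι_fiberGysin_one_eq_zero hf t t, map_zero]
  have hΦpr : ∀ W : complexBetti 𝒳 (2 * (p + 1)),
      complexBetti.map (fiberι f t) (2 * (p + 1)) (N (complexBetti.map (fiberι f t) (2 * (p + 1)) W)) =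
        complexBetti.map (fiberι f t) (2 * (p + 1)) (N (pr (complexBetti.map (fiberι f t) (2 * (p + 1)) W))) := by
    intro W
    conv_lhs => rw [← sum_lefschetzPowTo_primitivePart (hK t) (hvan_fiberOver hf t)
      (complexBetti.map (fiberι f t) (2 * (p + 1)) W)]
    rw [map_sum, map_sum, Finset.sum_eq_single top]
    · rw [hpr]
      exact congrArg _ (congrArg _ (lefschetzPowTo_zero_apply κ (2 * (p + 1)) _))
    · intro P _ hP
      obtain ⟨B, hB⟩ : ∃ B : complexBetti 𝒳 P.1.1, primitivePart κ d (hK t) (hvan_fiberOver hf t) P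
          (complexBetti.map (fiberι f t) (2 * (p + 1)) W) = complexBetti.map (fiberι f t) P.1.1 B :=
        exists_primitivePart_map_fiberι_eq deligne1968_invariantClass_fromTotalSpace_holds hf K hK W P t
      obtain ⟨⟨a, s⟩, hP'⟩ := P
      cases s with
      | zero =>
        exfalso
        exact hP (Subtype.ext (Prod.ext (by simp only; omega) rfl))
      | succ s =>
        dsimp only at hB ⊢
        rw [hB]
        exact hΦcop a s hP' B
    · intro h
      exact absurd (Finset.mem_univ _) h
  -- (3) `Ψ` maps into `E = P ∩ Im j^*` and is injective there (§4); Cayley–Hamilton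
  let E : Submodule ℂ (complexBetti (fiberOver f t) (2 * (p + 1))) :=
    primitiveClasses κ d (2 * (p + 1)) ⊓ LinearMap.range (complexBetti.map (fiberι f t) (2 * (p + 1))).hom
  have hξE : ξ ∈ E := ⟨hξP, hξI⟩
  have hΨE : ∀ x, Ψ x ∈ E := by
    intro x
    refine ⟨primitivePart_mem (hK t) (hvan_fiberOver hf t) top _, ?_⟩
    obtain ⟨B, hB⟩ : ∃ B : complexBetti 𝒳 (2 * (p + 1)), pr (complexBetti.map (fiberι f t) (2 * (p + 1)) (N x)) =
        complexBetti.map (fiberι f t) (2 * (p + 1)) B :=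
      exists_primitivePart_map_fiberι_eq deligne1968_invariantClass_fromTotalSpace_holds hf K hK (N x) top t
    exact ⟨B, hB.symm⟩
  let ΨE : Module.End ℂ E := Ψ.restrict fun x _ ↦ hΨE x
  have hΨE_val : ∀ x : E, ((ΨE x : E) : complexBetti (fiberOver f t) (2 * (p + 1))) = Ψ x := fun _ ↦ rfl
  have hinj : Function.Injective ΨE := by
    refine (injective_iff_map_eq_zero ΨE).2 fun x hx ↦ Subtype.ext ?_
    have hx' : Ψ x = 0 := by rw [← hΨE_val, hx]; rfl
    exact eq_zero_of_primitivePart_restrict_lift_eq_zero hf t D hK (r := p + 1) (by omega) θ hθ x.2.1 x.2.2 hx'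
  obtain ⟨sF, dF, hCH⟩ := exists_sum_smul_pow_comp_eq_id ΨE hinj
  -- the iterates: `Ψˡ ξ = pr j^* (Mˡ W₀)`
  obtain ⟨W₀, hW₀⟩ := hξI
  have hW₀' : complexBetti.map (fiberι f t) (2 * (p + 1)) W₀ = ξ := hW₀
  have hiter : ∀ l : ℕ, (((ΨE ^ l) ⟨ξ, hξE⟩ : E) : complexBetti (fiberOver f t) (2 * (p + 1))) =
      pr (complexBetti.map (fiberι f t) (2 * (p + 1)) ((M ^ l) W₀)) := by
    intro l
    induction l with
    | zero =>
      rw [pow_zero, pow_zero, Module.End.one_apply, Module.End.one_apply, hW₀']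
      change ξ = pr ξ
      have h := primitivePart_lefschetzPowTo_of_mem (hK t) (hvan_fiberOver hf t) top (by simp only [top]; omega) hξP
      have h0 : lefschetzPowTo κ top.1.2 top.1.1 (2 * (p + 1)) top.2 ξ = ξ := lefschetzPowTo_zero_apply κ (2 * (p + 1)) ξ
      rw [h0] at h
      rw [hpr]
      exact h.symm
    | succ l ih =>
      rw [pow_succ', pow_succ', Module.End.mul_apply, Module.End.mul_apply]
      change Ψ (((ΨE ^ l) ⟨ξ, hξE⟩ : E) : complexBetti (fiberOver f t) (2 * (p + 1))) = _
      rw [ih, hΨ, ← hΦpr, ← hM]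
  -- `ξ = pr j^* W'` with `W'` ALGEBRAIC
  set W' := ∑ k ∈ sF, dF k • (M ^ (k + 1)) W₀ with hW'
  have hW'alg : W' ∈ algebraicClasses 𝒳 (p + 1) :=
    Submodule.sum_mem _ fun k _ ↦ Submodule.smul_mem _ _ (hMpow k W₀ (by rw [hW₀']; exact hξalg))
  have hξW' : ξ = pr (complexBetti.map (fiberι f t) (2 * (p + 1)) W') := by
    have h := congrArg (fun g : Module.End ℂ E ↦ ((g ⟨ξ, hξE⟩ : E) : complexBetti (fiberOver f t) (2 * (p + 1)))) hCH
    simp only [LinearMap.comp_apply, LinearMap.id_apply, LinearMap.coe_sum, Finset.sum_apply, LinearMap.smul_apply,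
      Submodule.coe_sum, Submodule.coe_smul] at h
    rw [← h, hW', map_sum, map_sum]
    refine Finset.sum_congr rfl fun k _ ↦ ?_
    rw [map_smul, map_smul, ← hiter (k + 1), pow_succ, Module.End.mul_apply]
  -- (4) the top primitive part of `j^*W'` lifts (§5)
  rw [hξW', hpr]
  exact primitivePart_top_map_fiberι_mem_map hf t hKalg hK hKt hA hprev hW'alg

end Main


/-! ## §7 Consequences: the clause of the fibre discharged; the whole lift from the graded clauses; data exist -/

section Rows

variable {𝒳 S : SchemeOver ℂ} {d : ℕ} {f : 𝒳 ⟶ S}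

/-- **A Kähler–rational datum of the total space whose class polarises every fibre** (part XXI-a §3, keeping the datum:
the rational hyperplane class of a projective embedding of `𝒳`; its restriction to a fibre is the hyperplane class of the fibre).
[cite: VoisinHodgeI2002, Thm. 6.25, Rem. 6.27, §7.1.2 and Thm. 7.10] -/
theorem exists_kaehlerRationalDatum_polarization_fibres (hf : IsCompactAbelianPencil f d) (hd : 0 < d) :
    ∃ D : KaehlerRationalDatum (d + 1) 𝒳,
      ∀ s : ComplexPoints S, IsPolarizationClass d (fiberOver f s) (complexBetti.map (fiberι f s) 2 D.Hη) := by
  have h𝒳 := hf.isSmoothProjective_total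
  obtain ⟨N, ε, hε⟩ := h𝒳.isProjectiveOver
  haveI := hε
  obtain ⟨D, c, hc⟩ := exists_kaehlerRationalDatum_eq_map h𝒳 ε
  have hpol : IsPolarizationClass (d + 1) 𝒳 D.Hη := isPolarizationClass_Hη h𝒳 D
  refine ⟨D, fun s ↦ ⟨hpol.isRationalClass.map _, algebraicClasses_sup_ker_le_comap hf 1 s
    (Submodule.mem_sup_left hpol.mem_algebraicClasses), ?_⟩⟩
  -- `c ≠ 0`: otherwise `D.Hη = 0`, and hard Lefschetz on `𝒳` would force `H^{2d+2}(𝒳(ℂ); ℂ) = 0`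
  have hc0 : c ≠ 0 := by
    intro h0
    have hK0 : D.Hη = 0 := by rw [hc, h0, map_zero]
    obtain ⟨x, hx⟩ := exists_fiberGysin_map_fiberι_top_ne_zero hf s
    have hbij := bijective_lefschetzPowTo_of_hasHardLefschetz D.Hη (D.hLℂ h𝒳)
      (show 0 + (d + 1) = d + 1 by omega) (2 * (d + 1)) (by omega)
    obtain ⟨y, hy⟩ := hbij.2 (fiberGysin hf s d (complexBetti.map (fiberι f s) (2 * d) x))
    apply hx
    obtain ⟨d', rfl⟩ : ∃ d', d = d' + 1 := ⟨d - 1, by omega⟩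
    rw [← hy, lefschetzPowTo_succ_apply D.Hη (d' + 1) 0 (0 + 2 * (d' + 1)) (2 * (d' + 1 + 1)) rfl (by omega) (by omega),
      hK0, Literature.Geometry.Kaehler.lefschetzOperator_apply, LinearMap.map_zero, LinearMap.zero_apply]
  obtain ⟨r₀, -, hr₀⟩ := exists_isRationalClass_forall_eq_smul_projectiveSpace N
  obtain ⟨z, hz⟩ := hr₀ c
  have hz0 : z ≠ 0 := by
    rintro rfl
    exact hc0 (by rw [hz, zero_smul])
  have hgen : ∀ c' : complexBetti (projectiveSpace N ℂ) 2, ∃ w : ℂ, c' = w • c := fun c' ↦ by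
    obtain ⟨z', hz'⟩ := hr₀ c'
    exact ⟨z' * z⁻¹, by rw [hz', hz, smul_smul, mul_assoc, inv_mul_cancel₀ hz0, mul_one]⟩
  haveI : IsProper S.hom := IsSmoothProjective.isProper_holds hf.isSmoothProjective_base
  haveI : IsProper f.left := hf.isSmoothProjectiveFamily.isProper
  haveI : IsClosedImmersion (fiberι f s ≫ ε).left := isClosedImmersion_fiberι_comp_left_of_isPreimmersion f ε s
  have hHL := hasHardLefschetzProperty_map_of_forall_eq_smul (hf.isSmoothProjective_fiberOver s) (fiberι f s ≫ ε) hgen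
  have e : complexBetti.map (fiberι f s) 2 D.Hη = complexBetti.map (fiberι f s ≫ ε) 2 c := by
    rw [hc, complexBetti.map_comp, CategoryTheory.comp_apply]
  rw [e]
  exact hHL

/-- **(Prim)_t(p+1) ⟸ (L)_t(p) ∧ `A_{p+1}(𝒳, K)`, with the clause of the abelian fibre discharged** (Lieberman's theorem for
`X_t ≅ A.X`, part XXII-d `standardConjectureA_fiberOver`): at EVERY point of EVERY compact pencil of abelian varieties, for every
Kähler–rational datum of the total space polarising `X_t`. [cite: Lieberman1968, main theorem] [cite: Grothendieck1968, §3 p. 196 (A(X))]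
[cite: VoisinHodgeI2002, §6.3.2 Thm. 6.32] -/
theorem primitiveLift_succ_of_lefschetzDegree' (hf : IsCompactAbelianPencil f d) (t : ComplexPoints S)
    (D : KaehlerRationalDatum (d + 1) 𝒳)
    (hK : ∀ s : ComplexPoints S, HasHardLefschetzProperty (complexBetti.map (fiberι f s) 2 D.Hη) d)
    (hKt : IsPolarizationClass d (fiberOver f t) (complexBetti.map (fiberι f t) 2 D.Hη)) {p m : ℕ}
    (hpm : 2 * (p + 1) + m = d)
    (hprev : (algebraicClasses (fiberOver f t) p).comap (complexBetti.map (fiberι f t) (2 * p)).hom ≤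
      algebraicClasses 𝒳 p ⊔ LinearMap.ker (complexBetti.map (fiberι f t) (2 * p)).hom)
    (hAr : ∀ y ∈ algebraicClasses 𝒳 (p + 1 + m + 1), ∃ x ∈ algebraicClasses 𝒳 (p + 1),
      lefschetzPowTo D.Hη (m + 1) (2 * (p + 1)) (2 * (p + 1 + m + 1)) (by omega) x = y) :
    ∀ ξ ∈ algebraicClasses (fiberOver f t) (p + 1),
      ξ ∈ primitiveClasses (complexBetti.map (fiberι f t) 2 D.Hη) d (2 * (p + 1)) →
      ξ ∈ LinearMap.range (complexBetti.map (fiberι f t) (2 * (p + 1))).hom →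
      ξ ∈ (algebraicClasses 𝒳 (p + 1)).map (complexBetti.map (fiberι f t) (2 * (p + 1))).hom :=
  primitiveLift_succ_of_lefschetzDegree hf t D hK hKt hpm
    (fun p' r' q' _ _ h1 h2 ↦ ((standardConjectureA_fiberOver hf t hKt).2 p' r' q' h1 h2).surjOn) hprev hAr

/-- **THE ANDRÉ-AXIS LIFT IN EVERY DEGREE, AT EVERY POINT, FROM THE GRADED CLAUSES `A_r(𝒳, K)`, `4 ≤ 2r ≤ d`** (strong
induction: parts XVIII-i/XXI-a give (L)_t(0), (L)_t(1) and the step from (Prim); this part gives (Prim)_t(r) from (L)_t(r-1)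
and `A_r`). `K = D.Hη` the rational hyperplane class of a Kähler–rational datum of `𝒳`. No `HC_CM`, no CM point, no named fact.
[cite: Grothendieck1968, §3 p. 196 (A(X))] [cite: Lieberman1968, main theorem] [cite: Milne2020HodgeClassesAV, Prop. 1 (p. 7)] -/
theorem comap_le_sup_of_forall_lefschetzDegree (hf : IsCompactAbelianPencil f d) (t : ComplexPoints S)
    (D : KaehlerRationalDatum (d + 1) 𝒳)
    (hK : ∀ s : ComplexPoints S, HasHardLefschetzProperty (complexBetti.map (fiberι f s) 2 D.Hη) d)
    (hKt : IsPolarizationClass d (fiberOver f t) (complexBetti.map (fiberι f t) 2 D.Hη))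
    (hA : ∀ (r m : ℕ), 2 ≤ r → (hrm : 2 * r + m = d) → ∀ y ∈ algebraicClasses 𝒳 (r + m + 1),
      ∃ x ∈ algebraicClasses 𝒳 r, lefschetzPowTo D.Hη (m + 1) (2 * r) (2 * (r + m + 1)) (by omega) x = y) :
    ∀ p : ℕ, (algebraicClasses (fiberOver f t) p).comap (complexBetti.map (fiberι f t) (2 * p)).hom ≤
      algebraicClasses 𝒳 p ⊔ LinearMap.ker (complexBetti.map (fiberι f t) (2 * p)).hom := by
  have hKalg : D.Hη ∈ algebraicClasses 𝒳 1 := (isPolarizationClass_Hη hf.isSmoothProjective_total D).mem_algebraicClasses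
  have hAt := standardConjectureA_fiberOver hf t hKt
  intro p
  induction p using Nat.strong_induction_on with
  | _ p ih =>
    refine comap_le_sup_of_primitiveLift hf t hKalg hK hKt p
      (fun p' r' q' _ _ h1 h2 ↦ (hAt.2 p' r' q' h1 h2).surjOn) fun r h2r hrp hrd ↦ ?_
    obtain ⟨p', rfl⟩ : ∃ p', r = p' + 1 := ⟨r - 1, by omega⟩
    obtain ⟨m, hm⟩ : ∃ m, 2 * (p' + 1) + m = d := ⟨d - 2 * (p' + 1), by omega⟩
    exact primitiveLift_succ_of_lefschetzDegree' hf t D hK hKt hm (ih p' (by omega)) (hA (p' + 1) m h2r hm)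

/-- **W₆ (RANK-ONE `H⁴`-INVARIANTS): THE WHOLE LIFT AT `t` FROM THE SINGLE CLAUSE `A₃(𝒳, K)` OF THE SEVENFOLD** — on a
compact pencil of abelian SIXFOLDS whose invariant classes in `H⁴(X_t)` form a line (`ℂκ²`; e.g. large monodromy), (Prim)_t(2)
is vacuous (part XXI-e), so the André-axis lift in every degree at `t` follows from `L_K : N³(𝒳) → N⁴(𝒳)` ONTO (every
codimension-`4` algebraic class of the sevenfold total space is homologically `K ∪` a codimension-`3` algebraic class), `K` the
rational hyperplane class. NO `HC_CM`, no named fact, any point `t`. [cite: Grothendieck1968, §3 p. 196 (A(X))]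
[cite: vanGeemen1994HodgeAV, Thm. 6.12] [cite: Andre1996Motifs, §6.3 (p. 33)] -/
theorem forall_comap_le_sup_of_rankOne_of_lefschetzDegree_three {f : 𝒳 ⟶ S} (hf : IsCompactAbelianPencil f 6)
    (t : ComplexPoints S) (D : KaehlerRationalDatum (6 + 1) 𝒳)
    (hK : ∀ s : ComplexPoints S, HasHardLefschetzProperty (complexBetti.map (fiberι f s) 2 D.Hη) 6)
    (hKt : IsPolarizationClass 6 (fiberOver f t) (complexBetti.map (fiberι f t) 2 D.Hη))
    (h1 : Module.finrank ℂ (LinearMap.range (complexBetti.map (fiberι f t) (2 * 2)).hom) = 1)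
    (hA3 : ∀ y ∈ algebraicClasses 𝒳 4, ∃ x ∈ algebraicClasses 𝒳 3, lefschetzPowTo D.Hη 1 (2 * 3) (2 * 4) (by omega) x = y) :
    ∀ p : ℕ, (algebraicClasses (fiberOver f t) p).comap (complexBetti.map (fiberι f t) (2 * p)).hom ≤
      algebraicClasses 𝒳 p ⊔ LinearMap.ker (complexBetti.map (fiberι f t) (2 * p)).hom := by
  have hKalg : D.Hη ∈ algebraicClasses 𝒳 1 := (isPolarizationClass_Hη hf.isSmoothProjective_total D).mem_algebraicClasses
  have h2 : (algebraicClasses (fiberOver f t) 2).comap (complexBetti.map (fiberι f t) (2 * 2)).hom ≤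
      algebraicClasses 𝒳 2 ⊔ LinearMap.ker (complexBetti.map (fiberι f t) (2 * 2)).hom :=
    (comap_le_sup_two_iff_primitiveLift_two hf t hKalg hK hKt).2 (primitiveLift_two_of_finrank_range_four_eq_one hf t hK h1)
  exact (forall_comap_le_sup_iff_primitiveLift_three_of_rankOne hf t hKalg hK hKt h1).2
    (primitiveLift_succ_of_lefschetzDegree' hf t D hK hKt (p := 2) (m := 0) (by omega) h2 fun y hy ↦ hA3 y hy)

end Rows

end Summit.HodgeConjecture.HodgeConjecture.Ring2.AbelianAll

end
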